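import Literature.AlgebraicGeometry.HodgeTheory.AbelianVarietyCupMonomialDecompositions
import Literature.AlgebraicGeometry.HodgeTheory.AbelianVarietyEndomorphismMappingDegree
import HarnessLib

/-!
# Orientations of `A(ℂ)` and the top cohomology `H^{2g}(A(ℂ); ℤ) ≅ ℤ`: `[A(ℂ)]_{μ'} = ±[A(ℂ)]_μ`, `z ↦ ⟨z, [A(ℂ)]_μ⟩` is bijective,
# a top cup monomial of degree-one classes integrating to `1`, and all cup pairings of two orientations agree up to one global sign

Layer `Literature/AlgebraicGeometry/HodgeTheory`, namespace `Literature.AlgebraicGeometry.HodgeTheory` (theorems in the `AbelianVariety`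
namespace).  THEOREMS ONLY (no definition, no named fact, net debt 0).  Intrinsic orientation bookkeeping on the lane's ALGEBRAIC Betti
carrier `ComplexPoints A.X` (no torus-comparison data in the statements), from the tree's generic `exists_eq_smul_fundamentalClass_of_connectedSpace`
(`H_{2g}(A(ℂ); ℤ) = ℤ · [A(ℂ)]_μ`, Hatcher Thm. 3.26), `fundamentalClass_ne_zero`, the `A`-specific Kronecker perfectness
`bijective_kroneckerPairing` and torsion-freeness, and the cup-monomial decomposition of the top class (`exists_eq_cupPowOne_top`).

A. Hatcher, *Algebraic Topology* (2002), §3.3: Thm. 3.26 (a) and Lemma 3.27 (`Hₙ(M; ℤ) ≅ ℤ` generated by `[M]` for `M` closed connected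
orientable), p. 236 (`-μ` is the other orientation of a connected `M`), Prop. 3.38 and Cor. 3.39 (the cup pairing modulo torsion is
non-singular); H. Lange, *Abelian Varieties over the Complex Numbers* (2023), §1.1.3 (PDF pp. 24–27: `Hⁿ(X, ℤ) ≅ ⋀ⁿ Hom(Λ, ℤ)`, so `H^{2g}(X, ℤ) ≅ ℤ`)
and §6.2.4 (PDF p. 310: `d : H^{2g}(M, ℤ) ⥲ ℤ`, «depends only on the orientation of M»).

## What is proved

For `A : AbelianVariety ℂ` of dimension `g` and `ℤ`-orientations `μ, μ'` of `A(ℂ)` (degree `2g`):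

* §1 `mem_span_fundamentalClass`, `span_fundamentalClass_eq_top` (`H_{2g}(A(ℂ); ℤ) = ℤ · [A(ℂ)]_μ`), `fundamentalClass_ne_zero'`;
  `exists_kroneckerPairing_fundamentalClass_eq_one`; **`bijective_kroneckerPairing_fundamentalClass`** — `H^{2g}(A(ℂ); ℤ) → ℤ`,
  `z ↦ ⟨z, [A(ℂ)]_μ⟩` is bijective; `kroneckerPairing_fundamentalClass_eq_zero_iff`; `eq_of_kroneckerPairing_fundamentalClass_eq`;
* §2 **`fundamentalClass_eq_or_eq_neg`** — `[A(ℂ)]_{μ'} = [A(ℂ)]_μ ∨ [A(ℂ)]_{μ'} = -[A(ℂ)]_μ`;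
  **`exists_kroneckerPairing_cupPowOne_fundamentalClass_eq_one`** — there are `v₁, …, v_{2g} ∈ H¹(A(ℂ); ℤ)` with `⟨v₁ ⌣ ⋯ ⌣ v_{2g}, [A(ℂ)]_μ⟩ = 1`;
* §3 **`cupPairing_eq_or_eq_neg`** — all cup pairings of `μ'` and `μ` agree up to ONE global sign: `(∀ k l h, Q^{k,l}_{μ'} = Q^{k,l}_μ) ∨
  (∀ k l h, Q^{k,l}_{μ'} = -Q^{k,l}_μ)`; `intersectionForm_eq_or_eq_neg` (the middle intersection forms `Q_{μ'} = ±Q_μ` on `H^g(A(ℂ); ℤ)/T`).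

## References

* [HatcherAT2002] A. Hatcher, *Algebraic Topology*, CUP 2002 — §3.3 Thm. 3.26, Lemma 3.27, p. 236, Prop. 3.38, Cor. 3.39.
* [Lange2023AbelianVarietiesComplex] H. Lange, *Abelian Varieties over the Complex Numbers*, Springer 2023 — §1.1.3 (PDF pp. 24–27); §6.2.4 (PDF p. 310).

## Provenance
Lane `lit-hodgefound` (Hodge path, Track 2), prover seat `lit-hodgefound-p21` (generation 43), self-proposed row g43-#11 (CLAIM BY PATH).
-/

noncomputable section

open CategoryTheory Module Function
open Literature.AlgebraicTopology.SingularHomology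

universe u

namespace Literature.AlgebraicGeometry.HodgeTheory

open Literature.AlgebraicGeometry.Motives (ComplexPoints IsSmoothProjective AbelianVariety)

namespace AbelianVariety

variable (A : AbelianVariety ℂ)

/-! ### §1 `H_{2g}(A(ℂ); ℤ) = ℤ · [A(ℂ)]_μ` and `H^{2g}(A(ℂ); ℤ) ≅ ℤ` via `z ↦ ⟨z, [A(ℂ)]_μ⟩` -/

/-- **Every top homology class of `A(ℂ)` is an integral multiple of `[A(ℂ)]_μ`**: `H_{2g}(A(ℂ); ℤ) = ℤ · [A(ℂ)]_μ` (`A(ℂ)` is a closed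
connected oriented `2g`-manifold). [cite: HatcherAT2002, §3.3 Thm. 3.26 (a) and Lemma 3.27] -/
theorem mem_span_fundamentalClass (μ : HomologicalOrientation ℤ (ComplexPoints A.X) (2 * A.dim))
    (σ : singularHomology ℤ ℤ (ComplexPoints A.X) (2 * A.dim)) : σ ∈ Submodule.span ℤ {μ.fundamentalClass} := by
  have hX : IsSmoothProjective A.dim A.X := AbelianVariety.isSmoothProjective_holds (A := A)
  letI := hX.chartedSpace
  haveI := Motives.ComplexPoints.compactSpace_of_isSmoothProjective hX
  haveI := Motives.ComplexPoints.t2Space_of_isSmoothProjective hX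
  haveI := connectedSpace_complexPoints hX
  obtain ⟨c, hc⟩ := exists_eq_smul_fundamentalClass_of_connectedSpace μ σ
  exact Submodule.mem_span_singleton.2 ⟨c, hc.symm⟩

/-- **`H_{2g}(A(ℂ); ℤ)` is the line spanned by `[A(ℂ)]_μ`: `ℤ · [A(ℂ)]_μ = ⊤`.** [cite: HatcherAT2002, §3.3 Thm. 3.26 (a)] -/
theorem span_fundamentalClass_eq_top (μ : HomologicalOrientation ℤ (ComplexPoints A.X) (2 * A.dim)) :
    Submodule.span ℤ {μ.fundamentalClass} = (⊤ : Submodule ℤ (singularHomology ℤ ℤ (ComplexPoints A.X) (2 * A.dim))) :=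
  Submodule.eq_top_iff'.2 (mem_span_fundamentalClass A μ)

/-- **`[A(ℂ)]_μ ≠ 0`** for every `ℤ`-orientation `μ` of `A(ℂ)`. [cite: HatcherAT2002, §3.3 Thm. 3.26 (a)] -/
theorem fundamentalClass_ne_zero' (μ : HomologicalOrientation ℤ (ComplexPoints A.X) (2 * A.dim)) : μ.fundamentalClass ≠ 0 := by
  have hX : IsSmoothProjective A.dim A.X := AbelianVariety.isSmoothProjective_holds (A := A)
  letI := hX.chartedSpace
  haveI := Motives.ComplexPoints.compactSpace_of_isSmoothProjective hX
  haveI := Motives.ComplexPoints.t2Space_of_isSmoothProjective hX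
  haveI := connectedSpace_complexPoints hX
  exact fundamentalClass_ne_zero μ

/-- **There is a top class integrating to `1`: `∃ z ∈ H^{2g}(A(ℂ); ℤ)`, `⟨z, [A(ℂ)]_μ⟩ = 1`** — `[A(ℂ)]_μ` is a basis of `H_{2g}(A(ℂ); ℤ) ≅ ℤ`
and `H^{2g}(A(ℂ); ℤ) → Hom(H_{2g}(A(ℂ); ℤ), ℤ)` is onto. [cite: HatcherAT2002, §3.3 Thm. 3.26 (a) and Prop. 3.38] [cite: Lange2023AbelianVarietiesComplex, §6.2.4 (PDF p. 310)] -/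
theorem exists_kroneckerPairing_fundamentalClass_eq_one (μ : HomologicalOrientation ℤ (ComplexPoints A.X) (2 * A.dim)) :
    ∃ z : singularCohomology ℤ ℤ (ComplexPoints A.X) (2 * A.dim),
      kroneckerPairing ℤ ℤ (ComplexPoints A.X) (2 * A.dim) z μ.fundamentalClass = 1 := by
  haveI := free_singularHomology_int A (2 * A.dim)
  -- `[A(ℂ)]_μ` is a `ℤ`-basis of `H_{2g}(A(ℂ); ℤ)`
  have hli : LinearIndependent ℤ (fun _ : Fin 1 ↦ μ.fundamentalClass) :=
    linearIndependent_unique_iff.2 (fundamentalClass_ne_zero' A μ)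
  have hsp : ⊤ ≤ Submodule.span ℤ (Set.range fun _ : Fin 1 ↦ μ.fundamentalClass) := by
    rw [Set.range_const, span_fundamentalClass_eq_top]
  obtain ⟨z, hz⟩ := (bijective_kroneckerPairing A (2 * A.dim)).2 ((Basis.mk hli hsp).coord 0)
  exact ⟨z, by rw [hz]; exact Basis.mk_coord_apply_eq 0⟩

/-- **`H^{2g}(A(ℂ); ℤ) ≅ ℤ`: the map `z ↦ ⟨z, [A(ℂ)]_μ⟩` is BIJECTIVE for every `ℤ`-orientation `μ`** — injective because
`H_{2g}(A(ℂ); ℤ) = ℤ · [A(ℂ)]_μ` and the Kronecker pairing of `A(ℂ)` is perfect, surjective because some class integrates to `1`.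
[cite: HatcherAT2002, §3.3 Thm. 3.26 (a), Prop. 3.38 and Cor. 3.39] [cite: Lange2023AbelianVarietiesComplex, §1.1.3 (PDF pp. 24–27) and §6.2.4 (PDF p. 310)] -/
theorem bijective_kroneckerPairing_fundamentalClass (μ : HomologicalOrientation ℤ (ComplexPoints A.X) (2 * A.dim)) :
    Bijective fun z : singularCohomology ℤ ℤ (ComplexPoints A.X) (2 * A.dim) ↦
      kroneckerPairing ℤ ℤ (ComplexPoints A.X) (2 * A.dim) z μ.fundamentalClass := by
  -- the map is `ℤ`-linear: evaluation at `[A(ℂ)]_μ` after the Kronecker map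
  let e : singularCohomology ℤ ℤ (ComplexPoints A.X) (2 * A.dim) →ₗ[ℤ] ℤ :=
    (LinearMap.applyₗ μ.fundamentalClass).comp (kroneckerPairing ℤ ℤ (ComplexPoints A.X) (2 * A.dim))
  have he : ∀ z, e z = kroneckerPairing ℤ ℤ (ComplexPoints A.X) (2 * A.dim) z μ.fundamentalClass := fun z ↦ rfl
  change Bijective e
  constructor
  · rw [injective_iff_map_eq_zero]
    intro z hz
    rw [he] at hz
    apply (bijective_kroneckerPairing A (2 * A.dim)).1
    rw [map_zero]
    ext σ
    have hker : Submodule.span ℤ {μ.fundamentalClass} ≤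
        LinearMap.ker (kroneckerPairing ℤ ℤ (ComplexPoints A.X) (2 * A.dim) z) :=
      Submodule.span_le.2 (Set.singleton_subset_iff.2 (LinearMap.mem_ker.2 hz))
    rw [LinearMap.zero_apply]
    exact LinearMap.mem_ker.1 (hker (mem_span_fundamentalClass A μ σ))
  · obtain ⟨z₀, hz₀⟩ := exists_kroneckerPairing_fundamentalClass_eq_one A μ
    rw [← LinearMap.range_eq_top]
    exact Ideal.eq_top_of_isUnit_mem _ (LinearMap.mem_range.2 ⟨z₀, (he z₀).trans hz₀⟩) isUnit_one

/-- **`⟨z, [A(ℂ)]_μ⟩ = 0 ↔ z = 0`** for `z ∈ H^{2g}(A(ℂ); ℤ)`. [cite: HatcherAT2002, §3.3 Thm. 3.26 (a) and Cor. 3.39] -/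
theorem kroneckerPairing_fundamentalClass_eq_zero_iff (μ : HomologicalOrientation ℤ (ComplexPoints A.X) (2 * A.dim))
    (z : singularCohomology ℤ ℤ (ComplexPoints A.X) (2 * A.dim)) :
    kroneckerPairing ℤ ℤ (ComplexPoints A.X) (2 * A.dim) z μ.fundamentalClass = 0 ↔ z = 0 := by
  refine ⟨fun h ↦ (bijective_kroneckerPairing_fundamentalClass A μ).1 (h.trans ?_), fun h ↦ by rw [h, map_zero, LinearMap.zero_apply]⟩
  change (0 : ℤ) = kroneckerPairing ℤ ℤ (ComplexPoints A.X) (2 * A.dim) 0 μ.fundamentalClass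
  rw [map_zero, LinearMap.zero_apply]

/-- **Top classes are determined by their integral: `⟨z, [A(ℂ)]_μ⟩ = ⟨z', [A(ℂ)]_μ⟩ → z = z'`.** [cite: HatcherAT2002, §3.3 Cor. 3.39]
[cite: Lange2023AbelianVarietiesComplex, §6.2.4 (PDF p. 310)] -/
theorem eq_of_kroneckerPairing_fundamentalClass_eq (μ : HomologicalOrientation ℤ (ComplexPoints A.X) (2 * A.dim))
    {z z' : singularCohomology ℤ ℤ (ComplexPoints A.X) (2 * A.dim)}
    (h : kroneckerPairing ℤ ℤ (ComplexPoints A.X) (2 * A.dim) z μ.fundamentalClass =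
      kroneckerPairing ℤ ℤ (ComplexPoints A.X) (2 * A.dim) z' μ.fundamentalClass) : z = z' :=
  (bijective_kroneckerPairing_fundamentalClass A μ).1 h

/-! ### §2 Two orientations have the same fundamental class up to sign -/

/-- **ANY TWO `ℤ`-ORIENTATIONS OF `A(ℂ)` HAVE `[A(ℂ)]_{μ'} = [A(ℂ)]_μ` OR `[A(ℂ)]_{μ'} = -[A(ℂ)]_μ`**: `[A]_{μ'} = c · [A]_μ` and
`[A]_μ = c' · [A]_{μ'}` with `c' c = 1` in `ℤ` (read through a top class `z₀` with `⟨z₀, [A]_μ⟩ = 1`), so `c = ±1`.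
[cite: HatcherAT2002, §3.3 Thm. 3.26 (a), Lemma 3.27 and p. 236] -/
theorem fundamentalClass_eq_or_eq_neg (μ μ' : HomologicalOrientation ℤ (ComplexPoints A.X) (2 * A.dim)) :
    μ'.fundamentalClass = μ.fundamentalClass ∨ μ'.fundamentalClass = -μ.fundamentalClass := by
  obtain ⟨z₀, hz₀⟩ := exists_kroneckerPairing_fundamentalClass_eq_one A μ
  set φ := kroneckerPairing ℤ ℤ (ComplexPoints A.X) (2 * A.dim) z₀
  -- `φ = ⟨z₀, ·⟩` is injective on `H_{2g}(A(ℂ); ℤ) = ℤ · [A]_μ`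
  have key : ∀ σ₁ σ₂ : singularHomology ℤ ℤ (ComplexPoints A.X) (2 * A.dim), φ σ₁ = φ σ₂ → σ₁ = σ₂ := by
    intro σ₁ σ₂ h
    obtain ⟨d₁, hd₁⟩ := Submodule.mem_span_singleton.1 (mem_span_fundamentalClass A μ σ₁)
    obtain ⟨d₂, hd₂⟩ := Submodule.mem_span_singleton.1 (mem_span_fundamentalClass A μ σ₂)
    have e₁ := φ.map_smul d₁ μ.fundamentalClass
    have e₂ := φ.map_smul d₂ μ.fundamentalClass
    rw [hd₁, hz₀, smul_eq_mul, mul_one] at e₁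
    rw [hd₂, hz₀, smul_eq_mul, mul_one] at e₂
    rw [← hd₁, ← hd₂, ← e₁, ← e₂, h]
  obtain ⟨c, hc⟩ := Submodule.mem_span_singleton.1 (mem_span_fundamentalClass A μ μ'.fundamentalClass)
  obtain ⟨c', hc'⟩ := Submodule.mem_span_singleton.1 (mem_span_fundamentalClass A μ' μ.fundamentalClass)
  have e1 := φ.map_smul c μ.fundamentalClass
  rw [hc, hz₀, smul_eq_mul, mul_one] at e1
  have e2 := φ.map_smul c' μ'.fundamentalClass
  rw [hc', hz₀, e1, smul_eq_mul] at e2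
  rcases Int.eq_one_or_neg_one_of_mul_eq_one' e2.symm with ⟨-, hc1⟩ | ⟨-, hc1⟩
  · exact Or.inl (key _ _ (by rw [e1, hz₀, hc1]))
  · exact Or.inr (key _ _ (by rw [e1, map_neg, hz₀, hc1]))

/-- **A TOP CUP MONOMIAL OF DEGREE-ONE CLASSES INTEGRATING TO `1`: there are `v₁, …, v_{2g} ∈ H¹(A(ℂ); ℤ)` with
`⟨v₁ ⌣ ⋯ ⌣ v_{2g}, [A(ℂ)]_μ⟩ = 1`** (`g ≠ 0`; every top class is a cup monomial, `exists_eq_cupPowOne_top`).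
[cite: Lange2023AbelianVarietiesComplex, §1.1.3 (PDF pp. 24–27) and §6.2.4 (PDF p. 310)] [cite: HatcherAT2002, §3.3 Thm. 3.26 (a) and §3.2 Example 3.16] -/
theorem exists_kroneckerPairing_cupPowOne_fundamentalClass_eq_one (hA : A.dim ≠ 0)
    (μ : HomologicalOrientation ℤ (ComplexPoints A.X) (2 * A.dim)) :
    ∃ v : Fin (2 * A.dim) → singularCohomology ℤ ℤ (ComplexPoints A.X) 1,
      kroneckerPairing ℤ ℤ (ComplexPoints A.X) (2 * A.dim) (cupPowOne ℤ (ComplexPoints A.X) (2 * A.dim) v) μ.fundamentalClass = 1 := by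
  obtain ⟨z, hz⟩ := exists_kroneckerPairing_fundamentalClass_eq_one A μ
  obtain ⟨v, rfl⟩ := exists_eq_cupPowOne_top A hA z
  exact ⟨v, hz⟩

/-! ### §3 All cup pairings of two orientations agree up to one global sign -/

/-- **All cup pairings of two `ℤ`-orientations of `A(ℂ)` agree up to ONE global sign**: either `⟨x ⌣ y, [A(ℂ)]_{μ'}⟩ = ⟨x ⌣ y, [A(ℂ)]_μ⟩`
for all complementary degrees and all classes, or `⟨x ⌣ y, [A(ℂ)]_{μ'}⟩ = -⟨x ⌣ y, [A(ℂ)]_μ⟩` for all of them (`[A]_{μ'} = ±[A]_μ`).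
[cite: HatcherAT2002, §3.3 Thm. 3.26 (a), p. 236 and p. 250] -/
theorem cupPairing_eq_or_eq_neg (μ μ' : HomologicalOrientation ℤ (ComplexPoints A.X) (2 * A.dim)) :
    (∀ (k l : ℕ) (h : k + l = 2 * A.dim), cupPairing μ' h = cupPairing μ h) ∨
      ∀ (k l : ℕ) (h : k + l = 2 * A.dim), cupPairing μ' h = -cupPairing μ h := by
  rcases fundamentalClass_eq_or_eq_neg A μ μ' with hμ | hμ
  · refine Or.inl fun k l h ↦ LinearMap.ext fun x ↦ LinearMap.ext fun y ↦ ?_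
    rw [cupPairing_apply, cupPairing_apply, hμ]
  · refine Or.inr fun k l h ↦ LinearMap.ext fun x ↦ LinearMap.ext fun y ↦ ?_
    rw [LinearMap.neg_apply, LinearMap.neg_apply, cupPairing_apply, cupPairing_apply, hμ, map_neg]

/-- **The middle intersection forms of two orientations agree up to sign: `Q_{μ'} = Q_μ ∨ Q_{μ'} = -Q_μ` on `H^g(A(ℂ); ℤ)/T`.**
[cite: HatcherAT2002, §3.3 p. 236 and p. 250] -/
theorem intersectionForm_eq_or_eq_neg {k : ℕ} (μ μ' : HomologicalOrientation ℤ (ComplexPoints A.X) (2 * A.dim)) (hdeg : k + k = 2 * A.dim) :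
    intersectionForm hdeg μ' = intersectionForm hdeg μ ∨ intersectionForm hdeg μ' = -intersectionForm hdeg μ := by
  rcases cupPairing_eq_or_eq_neg A μ μ' with hμ | hμ
  · refine Or.inl (LinearMap.ext fun a ↦ LinearMap.ext fun b ↦ ?_)
    obtain ⟨x, rfl⟩ := freeCohomology.mk_surjective a
    obtain ⟨y, rfl⟩ := freeCohomology.mk_surjective b
    rw [intersectionForm_mk_mk, intersectionForm_mk_mk, hμ k k hdeg]
  · refine Or.inr (LinearMap.ext fun a ↦ LinearMap.ext fun b ↦ ?_)
    obtain ⟨x, rfl⟩ := freeCohomology.mk_surjective a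
    obtain ⟨y, rfl⟩ := freeCohomology.mk_surjective b
    rw [LinearMap.neg_apply, LinearMap.neg_apply, intersectionForm_mk_mk, intersectionForm_mk_mk, hμ k k hdeg,
      LinearMap.neg_apply, LinearMap.neg_apply]

end AbelianVariety

end Literature.AlgebraicGeometry.HodgeTheory

end
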